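import Summits.CriticalPhenomena.Ising3DConformalLimit.Theses.PerfectScreening
import Summits.CriticalPhenomena.Ising3DConformalLimit.Theses.AnomalousForcesInteraction
import Literature.Probability.LatticeModels.CriticalTwoPointLawDimension
import Literature.Probability.LatticeModels.PointwiseScalingLimitEtaExists
import HarnessLib

/-!
# Route `PerfectScreening`, support item `NonSaturation` (stmt-CriticalPhenomena-1342): structure lemmas

`NonSaturation` is the statement `∀ ε > 0, ∃ᶠ n in atTop, n·⟨σ₀σ_{n e₁}⟩⁺_{β_c(3)} < ε`, i.e.
`liminf_n n·G(n e₁) = 0` for the critical two-point function `G = criticalTwoPoint 3` of the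
nearest-neighbour Ising model on `ℤ³` — the weakest form of "`η(3) > 0`" (no saturation of the
Fröhlich–Simon–Spencer infrared bound `G ≤ C/‖x‖` at `β_c(3)`). It is an OPEN PROBLEM in print
(Duminil-Copin, ICM 2022, §4.2.1 and §8.4; Duminil-Copin–Panis 2025 move only the lower bounds);
nothing in this file proves or refutes it. What the tree does prove about it, unconditionally, is
recorded here (helper file, `--supports stmt-CriticalPhenomena-1342`; the equivalence "Coulomb
antecedent = `¬ NonSaturation`" was also observed, independently, by the disprover of crux
`CoulombImpliesNontrivial` in its workfile `Cruxes/CoulombImpliesNontrivial/Disproof.lean`, §1.3 —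
this file is the landed form):

* `not_nonSaturation_of_coulombLower`, `coulombLower_of_not_nonSaturation`,
  `nonSaturation_iff_not_coulombLower`, `nonSaturation_or_coulombLower`: by the
  Messager–Miracle-Solé inequalities in the form `G(3‖x‖_∞ e₁) ≤ G(x)`
  (`twoPointPlus_diagAxis_le_of_mem_sphere`, proved in the tree) and the Simon–Lieb-type lower
  bound `c‖x‖⁻² ≤ G` (`criticalTwoPoint_lower`, proved), `NonSaturation` is EQUIVALENT to the
  failure of a Coulomb lower bound `∃ c > 0, ∀ x ≠ 0, c/‖x‖ ≤ G(x)`. That Coulomb lower bound is,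
  verbatim, the hypothesis of the crux `CoulombImpliesNontrivial` and the conclusion of the support
  item `GaussianLimitIsCoulomb`; `nonSaturation_or_coulombLower` is the part of
  `ScreeningDichotomy` that needs neither `SubharmonicOffOrigin` nor `GreenAsymptotics`; and
  `nonSaturation_iff_frequently_cofinite`: the axial formulation is immaterial
  (`NonSaturation ⇔ liminf_{x→∞} ‖x‖·G(x) = 0` over all of `ℤ³`).
* `nonSaturation_of_tendsto_norm_mul`: perfect screening `‖x‖·G(x) → 0` (cofinitely) implies
  `NonSaturation`; `nonSaturation_of_rpow_decay` / `nonSaturation_of_etaPositive`: a power decay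
  `G ≤ C‖x‖^{-(1+κ)}`, `κ > 0` — the sibling crux `AnomalousForcesInteraction.EtaPositive`
  (stmt-CriticalPhenomena-2600) — implies `NonSaturation` (the ledger link 1342 ⇐ 2600); so do
  `HasIsingEtaBounds 3 η` and `HasIsingExponentEta 3 η` with `η > 0`
  (`nonSaturation_of_hasIsingEtaBounds`, `nonSaturation_of_hasIsingExponentEta`: `NonSaturation`
  is the weakest form of "`η(3) > 0`"), while `¬ NonSaturation ↔ HasIsingEtaBounds 3 0`
  (`not_nonSaturation_iff_hasIsingEtaBounds_zero`: saturation = the two-sided Coulomb law, `η = 0`).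
* `screeningDichotomy_iff_screeningUpgrade`: the support items `ScreeningDichotomy` (stmt-1348) and
  `ScreeningUpgrade` (stmt-1346) are EQUIVALENT (unconditionally, by `nonSaturation_or_coulombLower`).

Deliberately NOT repeated here (already landed in
`Theorems/PerfectScreeningGaussianLimitIsCoulombReductions.lean`): the rev-3 closure
`NonSaturation → GaussianLimitIsCoulomb → MoebiusLimitExists → Ising3DConformalLimit`
(`conjunct_of_nonSaturation_of_gaussianLimitIsCoulomb_of_moebiusLimitExists`), "Coulomb excludes
perfect screening" (`not_tendsto_norm_mul_of_coulomb`) and `GaussianLimitIsCoulomb ⇒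
GaussianLimitNotScreened`.

References: A. Messager, S. Miracle-Solé, J. Stat. Phys. 17 (1977) 245–262; H. Duminil-Copin,
*Lectures on the Ising and Potts models on the hypercubic lattice* (2019), Thm. 4.8 and eq. (4.10);
H. Duminil-Copin, ICM 2022, §4.2.1.
-/

noncomputable section

namespace Summit.CriticalPhenomena.Ising3DConformalLimit.Theorems

open Literature.Probability.LatticeModels Filter Topology
open Summit.CriticalPhenomena.Ising3DConformalLimit.Theses.PerfectScreening

/-! ### The axial sites `n e₁` -/

/-- `‖n e₁‖ = n` for the sup norm of `ℤ³` and `n : ℕ`. [folklore] -/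
theorem norm_single_natCast (n : ℕ) : ‖(Pi.single (0 : Fin 3) (n : ℤ) : Site 3)‖ = n := by
  rw [norm_single_axis, Int.cast_natCast, Nat.abs_cast]

/-- `n e₁ ≠ 0` for `n ≥ 1`. [folklore] -/
theorem single_natCast_ne_zero {n : ℕ} (hn : 1 ≤ n) :
    (Pi.single (0 : Fin 3) (n : ℤ) : Site 3) ≠ 0 := by
  intro h0
  have h := congrFun h0 0
  simp only [Pi.single_eq_same, Pi.zero_apply, Nat.cast_eq_zero] at h
  omega

/-- **Messager–Miracle-Solé, collapsed onto the first axis at `β_c(3)`**: for every `x ∈ ℤ³`,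
`⟨σ₀σ_{3‖x‖_∞ e₁}⟩⁺_{β_c} ≤ ⟨σ₀σ_x⟩⁺_{β_c}` (reflect into the positive orthant, collapse the mass
onto a maximal coordinate by diagonal moves, go out along the axis; Duminil-Copin 2019, eq. (4.10),
right half, "(Mes-Mir) used twice"; tree theorem `twoPointPlus_diagAxis_le_of_mem_sphere`). [cite: DuminilCopin2019, Exercise 37 (4), eq. (4.10), §4.3] -/
theorem criticalTwoPoint_three_mul_supNorm_le (x : Site 3) :
    criticalTwoPoint 3 (Pi.single (0 : Fin 3) (((3 * Site.supNorm x : ℕ)) : ℤ)) ≤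
      criticalTwoPoint 3 x := by
  have hd : 1 ≤ 3 := by norm_num
  have h := twoPointPlus_diagAxis_le_of_mem_sphere (d := 3) (β := criticalBeta 3)
    messager_miracleSole_holds messager_miracleSole_diag_holds
    twoPointPlus_reflection_invariant_holds twoPointPlus_perm_invariant_holds
    (criticalBeta_nonneg 3) hd (self_mem_sphere x)
  have h0 : (⟨0, hd⟩ : Fin 3) = 0 := Fin.ext (by simp)
  have hcast : (((3 * Site.supNorm x : ℕ)) : ℤ) = ((3 : ℕ) : ℤ) * (Site.supNorm x : ℕ) := by
    push_cast; ring
  rw [h0] at h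
  unfold criticalTwoPoint
  rw [hcast]
  exact h

/-! ### `NonSaturation` ⇔ no Coulomb lower bound -/

/-- A Coulomb lower bound `c/‖x‖ ≤ G(x)` (`x ≠ 0`, `c > 0`) forces `n·G(n e₁) ≥ c` for all `n ≥ 1`
and so refutes `NonSaturation` (take `ε := c`). In particular `NonSaturation` is exactly the
negation of the hypothesis of the crux `CoulombImpliesNontrivial`. [folklore] -/
theorem not_nonSaturation_of_coulombLower
    (h : ∃ c : ℝ, 0 < c ∧ ∀ x : Site 3, x ≠ 0 → c / ‖x‖ ≤ criticalTwoPoint 3 x) :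
    ¬ NonSaturation := by
  intro hNS
  obtain ⟨c, hc, hlow⟩ := h
  have hev : ∀ᶠ n : ℕ in atTop, c ≤ (n : ℝ) * criticalTwoPoint 3 (Pi.single 0 (n : ℤ)) := by
    filter_upwards [eventually_ge_atTop 1] with n hn
    have hx := hlow _ (single_natCast_ne_zero hn)
    rw [norm_single_natCast] at hx
    have hnpos : (0 : ℝ) < n := by exact_mod_cast hn
    rwa [div_le_iff₀ hnpos, mul_comm] at hx
  obtain ⟨n, hlt, hle⟩ := ((hNS c hc).and_eventually hev).exists
  exact absurd (hlt.trans_le hle) (lt_irrefl _)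

/-- Conversely, if `NonSaturation` fails then the critical two-point function obeys a Coulomb lower
bound `c/‖x‖ ≤ G(x)` for all `x ≠ 0`: eventually `n·G(n e₁) ≥ ε`, the Messager–Miracle-Solé
comparison `G(x) ≥ G(3‖x‖_∞ e₁)` gives `G(x) ≥ (ε/3)/‖x‖` for all large `x`, and the lower bound
`G ≥ c₀‖x‖⁻²` of Duminil-Copin 2019, Thm. 4.8 (`criticalTwoPoint_lower`) covers the finitely many
small `x ≠ 0`. [cite: DuminilCopin2019, Thm. 4.8 and eq. (4.10), §4.3–4.4] -/
theorem coulombLower_of_not_nonSaturation (h : ¬ NonSaturation) :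
    ∃ c : ℝ, 0 < c ∧ ∀ x : Site 3, x ≠ 0 → c / ‖x‖ ≤ criticalTwoPoint 3 x := by
  simp only [NonSaturation, not_forall, Filter.not_frequently, not_lt, exists_prop] at h
  obtain ⟨ε, hε, hev⟩ := h
  obtain ⟨N, hN⟩ := eventually_atTop.1 hev
  obtain ⟨c₀, hc₀, hlow⟩ := criticalTwoPoint_lower (d := 3) (by norm_num)
  refine ⟨min (ε / 3) (c₀ / (N + 1)), lt_min (by positivity) (by positivity), fun x hx => ?_⟩
  set m := Site.supNorm x with hm
  have hm1 : 1 ≤ m := Nat.pos_of_ne_zero fun h0 => hx (Site.supNorm_eq_zero_iff.1 h0)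
  have hnorm : ‖x‖ = (m : ℝ) := Site.norm_eq_supNorm x
  have hmpos : (0 : ℝ) < m := by exact_mod_cast hm1
  by_cases hle : N ≤ 3 * m
  · -- large `x`: Messager–Miracle-Solé
    have hax := hN (3 * m) hle
    have hMMS := criticalTwoPoint_three_mul_supNorm_le x
    have key : ε / 3 / (m : ℝ) ≤ criticalTwoPoint 3 x := by
      rw [div_div, div_le_iff₀ (by positivity)]
      calc ε ≤ ((3 * m : ℕ) : ℝ) * criticalTwoPoint 3 (Pi.single 0 (((3 * m : ℕ)) : ℤ)) := hax
        _ ≤ ((3 * m : ℕ) : ℝ) * criticalTwoPoint 3 x := by gcongr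
        _ = criticalTwoPoint 3 x * (3 * (m : ℝ)) := by push_cast; ring
    calc min (ε / 3) (c₀ / (N + 1)) / ‖x‖ ≤ (ε / 3) / ‖x‖ := by
          gcongr
          exact min_le_left _ _
      _ = ε / 3 / (m : ℝ) := by rw [hnorm]
      _ ≤ criticalTwoPoint 3 x := key
  · -- small `x`: the lower bound `c₀ ‖x‖⁻²`
    push Not at hle
    have hmN : (m : ℝ) ≤ N + 1 := by
      have : m ≤ N + 1 := by omega
      exact_mod_cast this
    have hlx := hlow x hx
    have hrpow : (‖x‖ : ℝ) ^ (-(((3 : ℕ) : ℝ) - 1)) = ((m : ℝ) ^ 2)⁻¹ := by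
      rw [hnorm, Real.rpow_neg (Nat.cast_nonneg m),
        show (((3 : ℕ) : ℝ) - 1) = ((2 : ℕ) : ℝ) by norm_num, Real.rpow_natCast]
    rw [hrpow] at hlx
    have hmm : (m : ℝ) * m ≤ (N + 1) * m := by nlinarith
    calc min (ε / 3) (c₀ / (N + 1)) / ‖x‖ ≤ (c₀ / (N + 1)) / ‖x‖ := by
          gcongr
          exact min_le_right _ _
      _ = c₀ / ((N + 1) * m) := by rw [hnorm, div_div]
      _ ≤ c₀ / ((m : ℝ) * m) := div_le_div_of_nonneg_left hc₀.le (by positivity) hmm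
      _ = c₀ * ((m : ℝ) ^ 2)⁻¹ := by rw [div_eq_mul_inv, pow_two]
      _ ≤ criticalTwoPoint 3 x := hlx

/-- **`NonSaturation` ⇔ no Coulomb lower bound.** The support item `NonSaturation` of route
`PerfectScreening` (`liminf_n n·G(n e₁) = 0`) holds iff the critical two-point function of the
nearest-neighbour Ising model on `ℤ³` admits NO lower bound `c/‖x‖ ≤ G(x)` (`c > 0`, `x ≠ 0`),
i.e. iff the hypothesis of the crux `CoulombImpliesNontrivial` fails (equivalently: iff the
two-sided Coulomb law `c/‖x‖ ≤ G ≤ C/‖x‖` fails, the upper half being the infrared bound). [folklore] -/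
theorem nonSaturation_iff_not_coulombLower :
    NonSaturation ↔ ¬ ∃ c : ℝ, 0 < c ∧ ∀ x : Site 3, x ≠ 0 → c / ‖x‖ ≤ criticalTwoPoint 3 x :=
  ⟨fun hNS hC => not_nonSaturation_of_coulombLower hC hNS,
    fun hC => by_contra fun hNS => hC (coulombLower_of_not_nonSaturation hNS)⟩

/-- **Non-saturation or Coulomb** (the part of `ScreeningDichotomy` that needs neither
`SubharmonicOffOrigin` nor `GreenAsymptotics`): either `liminf_n n·G(n e₁) = 0`, or
`c/‖x‖ ≤ G(x)` for all `x ≠ 0` with some `c > 0`. [folklore] -/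
theorem nonSaturation_or_coulombLower :
    NonSaturation ∨ ∃ c : ℝ, 0 < c ∧ ∀ x : Site 3, x ≠ 0 → c / ‖x‖ ≤ criticalTwoPoint 3 x := by
  by_cases h : NonSaturation
  · exact Or.inl h
  · exact Or.inr (coulombLower_of_not_nonSaturation h)

/-- **The axial formulation is immaterial**: `NonSaturation` (stated along `n e₁`) holds iff
`liminf ‖x‖·G(x) = 0` over ALL of `ℤ³`, i.e. iff for every `ε > 0` the set `{x : ‖x‖·G(x) < ε}` is
infinite (`→`: the axis is an injective sequence, tree lemma `tendsto_natCast_single_axis_cofinite`; `←`: otherwise `coulombLower_of_not_nonSaturation`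
gives `‖x‖·G(x) ≥ c` off the origin). [folklore] -/
theorem nonSaturation_iff_frequently_cofinite :
    NonSaturation ↔ ∀ ε : ℝ, 0 < ε → ∃ᶠ x : Site 3 in cofinite, ‖x‖ * criticalTwoPoint 3 x < ε := by
  constructor
  · intro h ε hε
    have h1 : ∃ᶠ x : Site 3 in map (fun n : ℕ => (Pi.single (0 : Fin 3) (n : ℤ) : Site 3)) atTop,
        ‖x‖ * criticalTwoPoint 3 x < ε := by
      rw [Filter.frequently_map]
      simpa only [norm_single_natCast] using h ε hε
    exact h1.filter_mono tendsto_natCast_single_axis_cofinite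
  · intro h
    by_contra hNS
    obtain ⟨c, hc, hlow⟩ := coulombLower_of_not_nonSaturation hNS
    have hev : ∀ᶠ x : Site 3 in cofinite, c ≤ ‖x‖ * criticalTwoPoint 3 x := by
      filter_upwards [eventually_cofinite_ne 0] with x hx
      have hxpos : 0 < ‖x‖ := norm_pos_iff.2 hx
      have h1 := hlow x hx
      rwa [div_le_iff₀ hxpos, mul_comm] at h1
    obtain ⟨x, hlt, hle⟩ := ((h c hc).and_eventually hev).exists
    exact absurd (hlt.trans_le hle) (lt_irrefl _)

/-! ### Sufficient conditions: perfect screening, power decay, `EtaPositive` -/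

/-- Perfect screening implies non-saturation: if `‖x‖·G(x) → 0` along the cofinite filter of `ℤ³`
(the conclusion of `ScreeningUpgrade`), then `NonSaturation` holds (restrict to the axis `n e₁`,
an injective sequence). [folklore] -/
theorem nonSaturation_of_tendsto_norm_mul
    (h : Tendsto (fun x : Site 3 => ‖x‖ * criticalTwoPoint 3 x) cofinite (𝓝 0)) :
    NonSaturation := by
  intro ε hε
  have hev : ∀ᶠ n : ℕ in atTop, (n : ℝ) * criticalTwoPoint 3 (Pi.single 0 (n : ℤ)) < ε := by
    filter_upwards [(h.comp tendsto_natCast_single_axis_cofinite).eventually (gt_mem_nhds hε)] with n hn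
    simpa only [Function.comp, norm_single_natCast] using hn
  exact hev.frequently

/-- A power-law upper bound with exponent `> 1`, `G(x) ≤ C‖x‖^{-(1+κ)}` for `x ≠ 0` with `κ > 0`
(`η > 0` in the upper-bound form), implies `NonSaturation`: `n·G(n e₁) ≤ C n^{-κ} → 0`. [folklore] -/
theorem nonSaturation_of_rpow_decay
    (h : ∃ κ C : ℝ, 0 < κ ∧ ∀ x : Site 3, x ≠ 0 →
      criticalTwoPoint 3 x ≤ C * (‖x‖ : ℝ) ^ (-(1 + κ))) :
    NonSaturation := by
  obtain ⟨κ, C, hκ, hup⟩ := h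
  intro ε hε
  have hlim : Tendsto (fun n : ℕ => C * (n : ℝ) ^ (-κ)) atTop (𝓝 0) := by
    have h1 := ((tendsto_rpow_neg_atTop hκ).comp tendsto_natCast_atTop_atTop).const_mul C
    simpa only [Function.comp, mul_zero] using h1
  have hev : ∀ᶠ n : ℕ in atTop, (n : ℝ) * criticalTwoPoint 3 (Pi.single 0 (n : ℤ)) < ε := by
    filter_upwards [hlim.eventually (gt_mem_nhds hε), eventually_ge_atTop 1] with n hn hn1
    have hx := hup _ (single_natCast_ne_zero hn1)
    rw [norm_single_natCast] at hx
    have hnpos : (0 : ℝ) < n := by exact_mod_cast hn1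
    calc (n : ℝ) * criticalTwoPoint 3 (Pi.single 0 (n : ℤ))
          ≤ n * (C * (n : ℝ) ^ (-(1 + κ))) := by gcongr
      _ = C * (n : ℝ) ^ (-κ) := by
          rw [show -(1 + κ) = -κ + (-1) by ring, Real.rpow_add hnpos, Real.rpow_neg_one]
          field_simp
      _ < ε := hn
  exact hev.frequently

/-- **The ledger link stmt-1342 ⇐ stmt-2600**: the sibling crux `EtaPositive` of route
`AnomalousForcesInteraction` (`∃ κ > 0, C, G(x) ≤ C‖x‖^{-(1+κ)}` for `x ≠ 0`) implies
`NonSaturation`. [folklore] -/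
theorem nonSaturation_of_etaPositive
    (h : Summit.CriticalPhenomena.Ising3DConformalLimit.Theses.AnomalousForcesInteraction.EtaPositive) :
    NonSaturation :=
  nonSaturation_of_rpow_decay h

/-- Two-sided `η`-bounds with `η > 0` (`HasIsingEtaBounds 3 η`: `c‖x‖^{-(1+η)} ≤ G ≤ C‖x‖^{-(1+η)}`)
imply `NonSaturation` (only the upper half is used). [folklore] -/
theorem nonSaturation_of_hasIsingEtaBounds {η : ℝ} (hη : 0 < η) (h : HasIsingEtaBounds 3 η) :
    NonSaturation := by
  unfold HasIsingEtaBounds IsPowerBounded at h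
  obtain ⟨c, C, -, hbd⟩ := h
  have he : (-(((3 : ℕ) : ℝ) - 2 + η)) = -(1 + η) := by norm_num
  refine nonSaturation_of_rpow_decay ⟨η, C, hη, fun x hx => ?_⟩
  have h2 := (hbd x hx).2
  rwa [he] at h2

/-- **`NonSaturation` is the weakest form of `η(3) > 0`**: if the anomalous dimension exists in the
logarithmic sense and is positive (`HasIsingExponentEta 3 η`, `η > 0`:
`log G(x)/log ‖x‖ → -(1+η)` cofinitely), then `NonSaturation` holds — along the axis eventually
`G(n e₁) < n^{-(1+η/2)}`, so `n·G(n e₁) < n^{-η/2} → 0`. [folklore] -/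
theorem nonSaturation_of_hasIsingExponentEta {η : ℝ} (hη : 0 < η) (h : HasIsingExponentEta 3 η) :
    NonSaturation := by
  intro ε hε
  have h' : Tendsto (fun x : Site 3 => Real.log (criticalTwoPoint 3 x) / Real.log ‖x‖) cofinite
      (𝓝 (-(((3 : ℕ) : ℝ) - 2 + η))) := h
  have he : (-(((3 : ℕ) : ℝ) - 2 + η)) = -(1 + η) := by norm_num
  rw [he] at h'
  have h1 : Tendsto (fun n : ℕ => Real.log (criticalTwoPoint 3 (Pi.single 0 (n : ℤ))) /
      Real.log (n : ℝ)) atTop (𝓝 (-(1 + η))) := by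
    refine (h'.comp tendsto_natCast_single_axis_cofinite).congr' (Eventually.of_forall fun n => ?_)
    simp only [Function.comp, norm_single_natCast]
  have h2 : ∀ᶠ n : ℕ in atTop,
      Real.log (criticalTwoPoint 3 (Pi.single 0 (n : ℤ))) / Real.log (n : ℝ) < -(1 + η / 2) :=
    h1.eventually (gt_mem_nhds (by linarith))
  have h3 : Tendsto (fun n : ℕ => (n : ℝ) ^ (-(η / 2))) atTop (𝓝 0) :=
    (tendsto_rpow_neg_atTop (by linarith : 0 < η / 2)).comp tendsto_natCast_atTop_atTop
  have hev : ∀ᶠ n : ℕ in atTop, (n : ℝ) * criticalTwoPoint 3 (Pi.single 0 (n : ℤ)) < ε := by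
    filter_upwards [h2, h3.eventually (gt_mem_nhds hε), eventually_ge_atTop 2] with n hn hnε hn2
    have hn1 : (1 : ℝ) < n := by exact_mod_cast hn2
    have hnpos : (0 : ℝ) < n := by linarith
    have hlogn : 0 < Real.log (n : ℝ) := Real.log_pos hn1
    have hG : 0 < criticalTwoPoint 3 (Pi.single 0 (n : ℤ)) := criticalTwoPoint_axis_pos n
    rw [div_lt_iff₀ hlogn] at hn
    have hGlt : criticalTwoPoint 3 (Pi.single 0 (n : ℤ)) < (n : ℝ) ^ (-(1 + η / 2)) := by
      rw [← Real.exp_log hG, Real.rpow_def_of_pos hnpos]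
      exact Real.exp_lt_exp.2 (by linarith)
    calc (n : ℝ) * criticalTwoPoint 3 (Pi.single 0 (n : ℤ)) < n * (n : ℝ) ^ (-(1 + η / 2)) := by
          gcongr
      _ = (n : ℝ) ^ (-(η / 2)) := by
          rw [show -(1 + η / 2) = -(η / 2) + (-1) by ring, Real.rpow_add hnpos, Real.rpow_neg_one]
          field_simp
      _ < ε := hnε
  exact hev.frequently

/-- **`¬ NonSaturation ⇔ HasIsingEtaBounds 3 0`**: saturation of the infrared bound along the axis is
the same as the two-sided Coulomb law `c‖x‖⁻¹ ≤ G ≤ C‖x‖⁻¹` (`η = 0` with bounds), the upper half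
being the tree's infrared bound `criticalTwoPoint_bounds_holds` (Fröhlich–Simon–Spencer 1976 /
Duminil-Copin 2019, Thm. 4.8). [cite: DuminilCopin2019, Thm. 4.8, §4.4] -/
theorem not_nonSaturation_iff_hasIsingEtaBounds_zero : ¬ NonSaturation ↔ HasIsingEtaBounds 3 0 := by
  have hexp : ∀ x : Site 3, (‖x‖ : ℝ) ^ (-(((3 : ℕ) : ℝ) - 2 + 0)) = ‖x‖⁻¹ := fun x => by
    rw [show (-(((3 : ℕ) : ℝ) - 2 + 0)) = -1 by norm_num, Real.rpow_neg_one]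
  unfold HasIsingEtaBounds IsPowerBounded
  constructor
  · intro hNS
    obtain ⟨c, hc, hlow⟩ := coulombLower_of_not_nonSaturation hNS
    obtain ⟨c₁, C, -, hbd⟩ := criticalTwoPoint_bounds_holds (d := 3) le_rfl
    refine ⟨c, C, hc, fun x hx => ⟨?_, ?_⟩⟩
    · rw [hexp, ← div_eq_mul_inv]
      exact hlow x hx
    · rw [add_zero]
      exact (hbd x hx).2
  · rintro ⟨c, C, hc, hbd⟩
    refine not_nonSaturation_of_coulombLower ⟨c, hc, fun x hx => ?_⟩
    have h1 := (hbd x hx).1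
    rwa [hexp, ← div_eq_mul_inv] at h1

/-! ### Consequence for the route: `ScreeningDichotomy ⇔ ScreeningUpgrade` -/

/-- **`ScreeningDichotomy ⇒ ScreeningUpgrade`** (items stmt-1348 ⇒ stmt-1346): given the
dichotomy "Coulomb lower bound or perfect screening" under `GreenAsymptotics` and
`SubharmonicOffOrigin`, the hypothesis `NonSaturation` of `ScreeningUpgrade` excludes the Coulomb
branch (`not_nonSaturation_of_coulombLower`), leaving `‖x‖·G(x) → 0`. [folklore] -/
theorem screeningUpgrade_of_screeningDichotomy (hD : ScreeningDichotomy) : ScreeningUpgrade := by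
  intro hGA hSubH hNS
  rcases hD hGA hSubH with hC | hS
  · exact absurd hNS (not_nonSaturation_of_coulombLower hC)
  · exact hS

/-- **`ScreeningUpgrade ⇒ ScreeningDichotomy`** (items stmt-1346 ⇒ stmt-1348): by
`nonSaturation_or_coulombLower`, either the Coulomb lower bound holds outright, or `NonSaturation`
holds and `ScreeningUpgrade` yields perfect screening. [folklore] -/
theorem screeningDichotomy_of_screeningUpgrade (hU : ScreeningUpgrade) : ScreeningDichotomy := by
  intro hGA hSubH
  rcases nonSaturation_or_coulombLower with hNS | hC
  · exact Or.inr (hU hGA hSubH hNS)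
  · exact Or.inl hC

/-- **The support items `ScreeningDichotomy` (stmt-1348) and `ScreeningUpgrade` (stmt-1346) are
equivalent** — unconditionally, by Messager–Miracle-Solé; a proof of either closes both. [folklore] -/
theorem screeningDichotomy_iff_screeningUpgrade : ScreeningDichotomy ↔ ScreeningUpgrade :=
  ⟨screeningUpgrade_of_screeningDichotomy, screeningDichotomy_of_screeningUpgrade⟩

end Summit.CriticalPhenomena.Ising3DConformalLimit.Theorems
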